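import Mathlib.Computability.Partrec
import Mathlib.Data.Rat.Denumerable
import Mathlib.Data.Complex.Basic
import Mathlib.Algebra.BigOperators.Group.Finset.Basic
import HarnessLib

-- provenance: harness21/H21/H21/Prelude/CplxCore/ComputableReal.lean @ 5958c5e (interim HEAD d8f2665); M5 mechanical rewrite
/-!
# Computable and elementary real numbers (trunk T-CPLX-CORE, item C20 / R8)

This file defines

* `Literature.CplxCore.IsComputableReal x`: the real number `x` is *computable* (Turing 1936; Weihrauch,
  *Computable Analysis* (2000), Def. 4.1.13): there is a computable sequence of rationals `f : ℕ → ℚ`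
  with `|x - f n| ≤ 2⁻ⁿ` for all `n` (a "fast Cauchy name").
* `Literature.CplxCore.computableReals : Set ℝ`, `Literature.CplxCore.IsComputableComplex z`.
* `Literature.CplxCore.ElementaryRec f`: the unary function `f : ℕ → ℕ` is *Kalmár elementary*
  (Kalmár 1943; Rose, *Subrecursion* (1984), Ch. 1), presented in the unary-with-`Nat.pair` style of
  Mathlib's `Nat.Primrec`: the closure of zero, successor, the pairing projections, addition, truncated
  subtraction and multiplication under pairing, composition, bounded sums and bounded products.
* `Literature.CplxCore.IsElementaryReal x`: `x` is an *elementary real* in the sense of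
  Tent–Ziegler, *Computable functions of reals*, Münster J. Math. 3 (2010), and Yoshinaga,
  *Periods and elementary real numbers* (2008): `x` is approximated to within `1/(n+1)` by
  `(a n - b n) / (c n + 1)` with `a b c` elementary.

## Mathlib anchors and design choices

* Computability of `f : ℕ → ℚ` is Mathlib's `Computable f` (`Mathlib.Computability.Partrec`); the
  `Primcodable ℚ` instance comes from `Denumerable ℚ` (`Mathlib.Data.Rat.Denumerable`) and is checked
  below by `inferInstance`.
* Mathlib has no notion of computable real and no Kalmár-elementary class (searched for
  `ComputableReal`, `Elementary`, `Kalmar`); `Nat.Primrec` is the model for `ElementaryRec`.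
* `computableReals` is a bare `Set ℝ` rather than a `Subfield ℝ`, so that the (sorried) closure lemmas
  stay out of structure fields.
* All API lemmas are stated with `sorry` proofs (standard facts: Weihrauch 2000, Thm. 4.3.2 for the
  field operations; Rose 1984 for elementary ⊆ primitive recursive).
-/

namespace Literature.Computability.Complexity

open scoped BigOperators

/-- Sanity check (outline C20 anchor): `ℚ` is `Primcodable` via `Denumerable ℚ`. -/
example : Primcodable ℚ := inferInstance

/-! ### Computable reals -/

/-- A real number `x` is *computable* if there is a computable fast Cauchy name for it: a computable
sequence `f : ℕ → ℚ` with `|x - f n| ≤ (1/2)^n` for every `n`.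
(Turing 1936; Weihrauch, *Computable Analysis* (2000), Def. 4.1.13 and Lemma 4.2.1.) [cite: Turing1936] -/
def IsComputableReal (x : ℝ) : Prop :=
  ∃ f : ℕ → ℚ, Computable f ∧ ∀ n : ℕ, |x - f n| ≤ (1 / 2 : ℝ) ^ n

/-- The set of computable real numbers (Weihrauch, *Computable Analysis* (2000), §4.1). It is a
countable real closed subfield of `ℝ`; the closure properties are the lemmas
`IsComputableReal.add`, `.neg`, `.mul` below. [folklore] -/
def computableReals : Set ℝ := {x | IsComputableReal x}

/-- Membership in `computableReals` is `IsComputableReal` (by definition). [folklore] -/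
@[simp] theorem mem_computableReals_iff (x : ℝ) : x ∈ computableReals ↔ IsComputableReal x :=
  Iff.rfl

/-- A complex number is *computable* if its real and imaginary parts are computable reals
(Weihrauch, *Computable Analysis* (2000), §4.1). [folklore] -/
def IsComputableComplex (z : ℂ) : Prop :=
  IsComputableReal z.re ∧ IsComputableReal z.im

/-- Characterisation of computable reals by Cauchy names with a computable modulus of convergence:
`x` is computable iff there are a computable sequence of rationals `f` converging to `x` and a
computable modulus `m : ℕ → ℕ` with `|x - f k| ≤ 1/(n+1)` for all `k ≥ m n`
(Weihrauch, *Computable Analysis* (2000), Thm. 4.1.5 / Lemma 4.2.1; Rice 1954). [cite: Rice1954] -/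
def isComputableReal_iff_modulus : Prop :=
  ∀ (x : ℝ),
    IsComputableReal x ↔
      ∃ (f : ℕ → ℚ) (m : ℕ → ℕ), Computable f ∧ Computable m ∧
        ∀ n k : ℕ, m n ≤ k → |x - f k| ≤ 1 / ((n : ℝ) + 1)

/-- Every rational number is a computable real (Weihrauch 2000, Example 4.1.4). [cite: Weihrauch2000, Example 4.1.4] -/
def IsComputableReal.ratCast : Prop :=
  ∀ (q : ℚ),
    IsComputableReal (q : ℝ)

/-- Computable reals are closed under addition (Weihrauch 2000, Thm. 4.3.2). [cite: Weihrauch2000, Thm. 4.3.2] -/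
def IsComputableReal.add : Prop :=
  ∀ {x y : ℝ} (hx : IsComputableReal x) (hy : IsComputableReal y),
    IsComputableReal (x + y)

/-- Computable reals are closed under negation (Weihrauch 2000, Thm. 4.3.2). [cite: Weihrauch2000, Thm. 4.3.2] -/
def IsComputableReal.neg : Prop :=
  ∀ {x : ℝ} (hx : IsComputableReal x),
    IsComputableReal (-x)

/-- Computable reals are closed under multiplication (Weihrauch 2000, Thm. 4.3.2). [cite: Weihrauch2000, Thm. 4.3.2] -/
def IsComputableReal.mul : Prop :=
  ∀ {x y : ℝ} (hx : IsComputableReal x) (hy : IsComputableReal y),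
    IsComputableReal (x * y)

/-! ### Kalmár elementary functions -/

/-- The *Kalmár elementary* unary functions `ℕ → ℕ`, in the unary-with-`Nat.pair` style of Mathlib's
`Nat.Primrec` (Kalmár 1943; Rose, *Subrecursion: functions and hierarchies* (1984), Ch. 1;
Tent–Ziegler 2010, §2). Multi-ary functions are encoded through `Nat.pair`/`Nat.unpair`: the class is
the closure of zero, successor, the two unpairing projections, addition, truncated subtraction and
multiplication (each applied to an unpaired argument), under pairing, composition, and the bounded sum
`(z, n) ↦ ∑ i < n, f (z, i)` and bounded product `(z, n) ↦ ∏ i < n, f (z, i)`.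
This lives in `Literature.CplxCore`, not in Mathlib's `Nat` namespace. [cite: Kalmar1943] -/
inductive ElementaryRec : (ℕ → ℕ) → Prop
  /-- The constant zero function is elementary. -/
  | zero : ElementaryRec fun _ => 0
  /-- The successor function is elementary. -/
  | succ : ElementaryRec Nat.succ
  /-- The first unpairing projection is elementary. -/
  | left : ElementaryRec fun n => n.unpair.1
  /-- The second unpairing projection is elementary. -/
  | right : ElementaryRec fun n => n.unpair.2
  /-- Addition of the two unpaired components is elementary. -/
  | add : ElementaryRec (Nat.unpaired (· + ·))
  /-- Truncated subtraction of the two unpaired components is elementary. -/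
  | tsub : ElementaryRec (Nat.unpaired fun a b => a - b)
  /-- Multiplication of the two unpaired components is elementary. -/
  | mul : ElementaryRec (Nat.unpaired (· * ·))
  /-- Elementary functions are closed under pairing. -/
  | pair {f g : ℕ → ℕ} :
      ElementaryRec f → ElementaryRec g → ElementaryRec fun n => Nat.pair (f n) (g n)
  /-- Elementary functions are closed under composition. -/
  | comp {f g : ℕ → ℕ} : ElementaryRec f → ElementaryRec g → ElementaryRec fun n => f (g n)
  /-- Bounded sum: if `f` is elementary then so is `(z, n) ↦ ∑ i < n, f (z, i)`. -/
  | boundedSum {f : ℕ → ℕ} :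
      ElementaryRec f →
        ElementaryRec (Nat.unpaired fun z n => ∑ i ∈ Finset.range n, f (Nat.pair z i))
  /-- Bounded product: if `f` is elementary then so is `(z, n) ↦ ∏ i < n, f (z, i)`. -/
  | boundedProd {f : ℕ → ℕ} :
      ElementaryRec f →
        ElementaryRec (Nat.unpaired fun z n => ∏ i ∈ Finset.range n, f (Nat.pair z i))

/-- Every Kalmár elementary function is primitive recursive (Rose, *Subrecursion* (1984), Thm. 1.2;
the elementary functions form the third Grzegorczyk level `𝓔³ ⊊` primitive recursive). [cite: Rose1984, Ch. 1 Thm. 1.2] -/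
def ElementaryRec.primrec : Prop :=
  ∀ {f : ℕ → ℕ} (hf : ElementaryRec f),
    Nat.Primrec f

/-! ### Elementary reals -/

/-- A real number `x` is *elementary* (Tent–Ziegler, *Computable functions of reals*, Münster J. Math.
3 (2010), §1; Yoshinaga, *Periods and elementary real numbers*, arXiv:0805.0349, Def. 2) if there are
Kalmár elementary functions `a b c : ℕ → ℕ` with `|x - (a n - b n) / (c n + 1)| ≤ 1/(n+1)` for all
`n`. Yoshinaga proved that all Kontsevich–Zagier periods are elementary reals. [cite: arXiv08050349] -/
def IsElementaryReal (x : ℝ) : Prop :=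
  ∃ a b c : ℕ → ℕ, ElementaryRec a ∧ ElementaryRec b ∧ ElementaryRec c ∧
    ∀ n : ℕ, |x - ((a n : ℝ) - b n) / ((c n : ℝ) + 1)| ≤ 1 / ((n : ℝ) + 1)

/-- Every elementary real is computable (Tent–Ziegler 2010, §1: elementary functions are computable,
and a `1/(n+1)`-name can be computably accelerated to a `2⁻ⁿ`-name). [cite: TentZiegler2010, §1: elementary functions are computable] -/
def IsElementaryReal.isComputableReal : Prop :=
  ∀ {x : ℝ} (hx : IsElementaryReal x),
    IsComputableReal x

/-! ### Discharges -/

/-- Auxiliary for `ElementaryRec.primrec_holds`: a bounded fold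
`(z, n) ↦ op (… op (op e (f (z,0))) (f (z,1)) …) (f (z,n-1))` of a primitive recursive `f` along a
primitive recursive binary operation `op` is primitive recursive (an instance of primitive
recursion, `Nat.Primrec.prec`). [folklore] -/
private theorem primrec_boundedFold {f : ℕ → ℕ} (hf : Nat.Primrec f) {op : ℕ → ℕ → ℕ}
    (hop : Nat.Primrec (Nat.unpaired op)) (e : ℕ) (F : ℕ → ℕ → ℕ)
    (hF0 : ∀ z, F z 0 = e) (hFs : ∀ z n, F z (n + 1) = op (F z n) (f (Nat.pair z n))) :
    Nat.Primrec (Nat.unpaired F) := by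
  have h := Nat.Primrec.prec (Nat.Primrec.const e)
    (hop.comp (Nat.Primrec.pair (Nat.Primrec.right.comp Nat.Primrec.right)
      (hf.comp (Nat.Primrec.pair Nat.Primrec.left (Nat.Primrec.left.comp Nat.Primrec.right)))))
  refine h.of_eq ?_
  intro p
  simp only [Nat.unpaired, Nat.unpair_pair]
  induction p.unpair.2 with
  | zero => simp [hF0]
  | succ n ih => simp [hFs, ih]

/-- Discharge of `ElementaryRec.primrec`: every Kalmár elementary function is primitive recursive
(Rose, *Subrecursion: functions and hierarchies* (1984), Ch. 1, Thm. 1.2: `𝓔³` is contained in the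
primitive recursive functions). Proof: structural induction on `ElementaryRec`; the initial functions,
pairing and composition are constructors/lemmas of `Nat.Primrec`, and bounded sums and products are
instances of primitive recursion (`primrec_boundedFold`). [cite: Rose1984, Ch. 1 Thm. 1.2] -/
theorem ElementaryRec.primrec_holds : ElementaryRec.primrec := by
  intro f hf
  induction hf with
  | zero => exact Nat.Primrec.zero
  | succ => exact Nat.Primrec.succ
  | left => exact Nat.Primrec.left
  | right => exact Nat.Primrec.right
  | add => exact Nat.Primrec.add
  | tsub => exact Nat.Primrec.sub
  | mul => exact Nat.Primrec.mul
  | pair _ _ ihf ihg => exact ihf.pair ihg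
  | comp _ _ ihf ihg => exact ihf.comp ihg
  | boundedSum _ ih =>
      exact primrec_boundedFold ih Nat.Primrec.add 0 _ (fun z => by simp)
        (fun z n => Finset.sum_range_succ _ _)
  | boundedProd _ ih =>
      exact primrec_boundedFold ih Nat.Primrec.mul 1 _ (fun z => by simp)
        (fun z n => Finset.prod_range_succ _ _)

end Literature.Computability.Complexity
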